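import Summits.BirchSwinnertonDyer.BirchSwinnertonDyer.Theorems.KolyvaginRankRigidityAtTwoWalkBridge
import Summits.BirchSwinnertonDyer.BirchSwinnertonDyer.Theorems.KolyvaginRankRigidityAtTwoWalkStepPureLocal
import Summits.BirchSwinnertonDyer.BirchSwinnertonDyer.Theorems.KolyvaginRankRigidityAtTwoWalkStepSign
import Summits.BirchSwinnertonDyer.BirchSwinnertonDyer.Theorems.KolyvaginRankRigidityAtTwoSwapWeilDatumLiftChange
import Summits.BirchSwinnertonDyer.BirchSwinnertonDyer.Theorems.KolyvaginRankRigidityAtTwoWalkEngineAdapterG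
import Summits.BirchSwinnertonDyer.BirchSwinnertonDyer.Theorems.KolyvaginRankRigidityAtTwoWalkStepPureAlgebra
import HarnessLib

/-!
# Crux U1 `KolyvaginBoundedDefectAtTwo` (stmt-BirchSwinnertonDyer-28083), LINE 17 `regular_core_rigidity`,
# stub S1b `stub_nearCoreExistenceAtTwo` — THE WALK, part 2: the PURE STEP at frame level

Width seat `bsd-line-krr2-p2` g15 (ONE READER on S1b); `--supports stmt-BirchSwinnertonDyer-28083` (helper).
THEOREMS ONLY; nothing here proves S1b, U1, a rung or BSD. BSD is NOT proved.
Frame conventions as in `…WalkStepGood`. `walkStep_pure`: cut ONE alive eigenclass `p = g_{i₁}` (sign `s`) at a regular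
Kolyvagin prime killing the other alive classes (engine p691126); the pure cut yields a REFILL class `r` (p692147) whose
SIGN (p688390) makes `q' = τ_* r − s r` an eigenclass of sign `−s` (`oppositeSign_class`); the frame `g[i₁ ↦ q']` on the
same alive set satisfies (F3) with exponent `J + 2d + 1` and (F4) with exponent `8d + 2J + 7` at `H_{𝓕(cℓ)}`.
[cite: MazurRubin2004, §4.1, Prop. 4.1.5] [cite: Jetchev2008, Lemma 5.2, proof of Prop. 5.3] [cite: GrossLMS1991, §5 (5.1), §9]
Design: no definitions; `K : Type`; axioms `propext`, `Classical.choice`, `Quot.sound`.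
-/

set_option autoImplicit false
-- the Theorems namespace of this sub repeats the summit name by design (D-0017 nested layout)
set_option linter.dupNamespace false

noncomputable section

open scoped Classical
open Function NumberField IsDedekindDomain WeierstrassCurve Field Finset
open Literature.NumberTheory.EllipticCurves Literature.NumberTheory.EllipticCurves.Jetchev2008
open Literature.NumberTheory.EllipticCurves.KolyvaginPairing
open Literature.NumberTheory.GaloisRepresentations Literature.NumberTheory.GaloisCohomology
open Literature.NumberTheory.GaloisRepresentations.DiscreteGaloisModule (transverseSubgroup SelmerStructure)
open Literature.NumberTheory.Automorphic
open Summit.BirchSwinnertonDyer.Rank1Residual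
open Summit.BirchSwinnertonDyer.Rank1Residual.JET.SelmerVocabulary
open Summit.BirchSwinnertonDyer.Rank1Residual.JET.GlobalDuality (smul_place_eq_self_of_natCast_mem)
open Summit.BirchSwinnertonDyer.BirchSwinnertonDyer.Theorems.KolyvaginLowerBoundAtTwo (torsionFixing_le_of_dvd
  weil_equivariant_of_isLiftOfAut)

namespace Summit.BirchSwinnertonDyer.BirchSwinnertonDyer.Theorems.KolyvaginAtTwo.RegularWalk

variable {K : Type} [Field K] [NumberField K] (W : WeierstrassCurve ℚ) [W.IsElliptic] [W.IsGloballyMinimal]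

/-! ### §2 The pure step -/

set_option maxHeartbeats 800000 in
/-- **THE PURE STEP OF THE REGULAR-PRIME WALK** (frame level; see the module docstring and `…WalkStepGood`).
[cite: MazurRubin2004, §4.1, Prop. 4.1.5] [cite: Jetchev2008, Lemma 5.2, proof of Prop. 5.3] [cite: GrossLMS1991, §9] -/
theorem walkStep_pure (k : ℕ) (hk : 1 ≤ k)
    (e : geomTorsion (W.baseChange K) ((2 ^ k : ℕ) : ℤ) → geomTorsion (W.baseChange K) ((2 ^ k : ℕ) : ℤ) →
      AlgebraicClosure K)
    (hμ : ∀ S T, e S T ^ (2 ^ k) = 1)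
    (hadd₁ : ∀ S₁ S₂ T, e (S₁ + S₂) T = e S₁ T * e S₂ T)
    (hadd₂ : ∀ S T₁ T₂, e S (T₁ + T₂) = e S T₁ * e S T₂)
    (hgal : ∀ (γ : absoluteGaloisGroup K) (S T : geomTorsion (W.baseChange K) ((2 ^ k : ℕ) : ℤ)),
      γ • e S T = e (γ • S) (γ • T))
    (halt : ∀ T, e T T = 1) (hnondeg : ∀ T, (∀ S, e S T = 1) → T = 0)
    (inv : LocalInvariants K (2 ^ k)) (hperf : inv.IsPerfect) (hvan : inv.SumLocalTermEqZero)
    (hcomp : inv.SelmerComplement)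
    (hK : IsImaginaryQuadratic K) (hD : NumberField.discr K < -4) (hodd : Odd (NumberField.discr K))
    (ι : K →+* ℂ) [∀ j : ℕ, NumberField (ringClassField K ι j)] [NeZero (W.conductorNorm ℤ)]
    (hH : SatisfiesHeegnerHypothesis (W.conductorNorm ℤ) K)
    (hρ2 : W.HasSurjectiveModNGaloisRep 2) (hsurj : W.HasSurjectiveModNGaloisRep ((2 ^ (k + 1) : ℕ) : ℤ))
    {τ : K ≃ₐ[ℚ] K} (hτ1 : τ ≠ 1)
    (hτe : ∀ S T, liftAut τ (e S T) =
      e ((isLiftOfAut_liftAut τ).torsionMap W ((2 ^ k : ℕ) : ℤ) S) ((isLiftOfAut_liftAut τ).torsionMap W ((2 ^ k : ℕ) : ℤ) T))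
    (hinvc : inv.IsConjCompatible τ)
    {c : ℕ} (hc : Squarefree c)
    (hkol : ∀ ℓ ∈ c.primeFactors, Zhang2014.IsKolyvaginPrime (W.conductorNorm ℤ) W K 2 ℓ)
    (hkM : ∀ ℓ ∈ c.primeFactors, k + 1 ≤ Zhang2014.kolyvaginIndex W 2 ℓ)
    {m : ℕ} (g : Fin m → galH1Torsion (W.baseChange K) ((2 ^ k : ℕ) : ℤ))
    (sg : Fin m → ℤ) (A : Finset (Fin m))
    (hgS : ∀ i ∈ A, g i ∈ modifiedSelmerGroup W K ι ((2 ^ k : ℕ) : ℤ) c)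
    (hsg : ∀ i, sg i = 1 ∨ sg i = -1)
    (hgτ : ∀ i, conjAct W τ ((2 ^ k : ℕ) : ℤ) (g i) = sg i • g i)
    {J d : ℕ}
    (hF3 : ∀ u : galH1Torsion (W.baseChange K) ((2 ^ k : ℕ) : ℤ), u ∈ modifiedSelmerGroup W K ι ((2 ^ k : ℕ) : ℤ) c →
      ∃ b : Fin m → ℤ, ∀ ρ ∈ torsionFixing (W.baseChange K) ((2 ^ (k + 1) : ℕ) : ℤ),
        h1Eval (W.baseChange K) ((2 ^ k : ℕ) : ℤ) (((2 : ℤ) ^ J) • u - ∑ i ∈ A, b i • g i) ρ = 0)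
    (hF4 : ∀ b : Fin m → ℤ, (∀ ρ ∈ torsionFixing (W.baseChange K) ((2 ^ (k + 1) : ℕ) : ℤ),
        h1Eval (W.baseChange K) ((2 ^ k : ℕ) : ℤ) (∑ i ∈ A, b i • g i) ρ = 0) → ∀ i ∈ A, (2 : ℤ) ^ (k - d) ∣ b i)
    {i₁ : Fin m} (hi₁ : i₁ ∈ A) (bnd : ℕ) :
    ∃ ℓ : ℕ, bnd < ℓ ∧ ¬ ℓ ∣ c ∧ Zhang2014.IsKolyvaginPrime (W.conductorNorm ℤ) W K 2 ℓ ∧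
      k + 1 ≤ Zhang2014.kolyvaginIndex W 2 ℓ ∧
      (∃ (v₁ : HeightOneSpectrum (𝓞 ℚ)) (𝔓₁ : Ideal (absIntegers (𝓞 ℚ) ℚ)) (h : absoluteGaloisGroup ℚ),
        (ℓ : 𝓞 ℚ) ∈ v₁.asIdeal ∧ 𝔓₁ ∈ v₁.primesAbove ∧ IsArithFrobAt (𝓞 ℚ) h 𝔓₁ ∧
        (∀ X : geomTorsion W ((2 ^ k : ℕ) : ℤ), h • h • X = X) ∧
        ∃ P : geomTorsion W ((2 ^ k : ℕ) : ℤ), (2 : ℤ) ^ (k - 1) • (P + h • P) ≠ 0) ∧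
      ∃ q' : galH1Torsion (W.baseChange K) ((2 ^ k : ℕ) : ℤ),
        q' ∈ modifiedSelmerGroup W K ι ((2 ^ k : ℕ) : ℤ) (c * ℓ) ∧
        conjAct W τ ((2 ^ k : ℕ) : ℤ) q' = (-sg i₁) • q' ∧
        (∀ i ∈ A.erase i₁, g i ∈ modifiedSelmerGroup W K ι ((2 ^ k : ℕ) : ℤ) (c * ℓ)) ∧
        (∀ u : galH1Torsion (W.baseChange K) ((2 ^ k : ℕ) : ℤ),
          u ∈ modifiedSelmerGroup W K ι ((2 ^ k : ℕ) : ℤ) (c * ℓ) → ∃ b : Fin m → ℤ,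
          ∀ ρ ∈ torsionFixing (W.baseChange K) ((2 ^ (k + 1) : ℕ) : ℤ),
            h1Eval (W.baseChange K) ((2 ^ k : ℕ) : ℤ)
              (((2 : ℤ) ^ (J + 2 * d + 1)) • u - ∑ i ∈ A, b i • Function.update g i₁ q' i) ρ = 0) ∧
        (∀ b : Fin m → ℤ, (∀ ρ ∈ torsionFixing (W.baseChange K) ((2 ^ (k + 1) : ℕ) : ℤ),
            h1Eval (W.baseChange K) ((2 ^ k : ℕ) : ℤ) (∑ i ∈ A, b i • Function.update g i₁ q' i) ρ = 0) →
          ∀ i ∈ A, (2 : ℤ) ^ (k - (8 * d + 2 * J + 7)) ∣ b i) := by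
  classical
  haveI : NeZero (2 ^ k) := ⟨pow_ne_zero k two_ne_zero⟩
  haveI hEK : (W.baseChange K).IsElliptic := by rw [baseChange]; infer_instance
  haveI : Finite (geomTorsion (W.baseChange K) ((2 ^ k : ℕ) : ℤ)) :=
    finite_geomTorsion_of_neZero (W.baseChange K) (2 ^ k)
  set S := modifiedSelmerGroup W K ι ((2 ^ k : ℕ) : ℤ) c with hSdef
  haveI : Finite S := finite_modifiedSelmerGroup W ι (n := ((2 ^ k : ℕ) : ℤ)) (by positivity) hc
  have hSτ : ∀ x ∈ S, conjAct W τ ((2 ^ k : ℕ) : ℤ) x ∈ S := fun x hx ↦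
    conjAct_mem_modifiedSelmerGroup W hK ι k hc hx τ
  set s := sg i₁ with hsdef
  have hs : s = 1 ∨ s = -1 := hsg i₁
  have hs2 : s * s = 1 := by rcases hs with h | h <;> simp [h]
  have hpτ : conjAct W τ ((2 ^ k : ℕ) : ℤ) (g i₁) = s • g i₁ := hgτ i₁
  set A' := A.erase i₁ with hA'
  have hA'A : A' ⊆ A := Finset.erase_subset _ _
  have hi₁A' : i₁ ∉ A' := Finset.notMem_erase i₁ A
  have hsplit : ∀ f : Fin m → galH1Torsion (W.baseChange K) ((2 ^ k : ℕ) : ℤ),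
      ∑ i ∈ A, f i = f i₁ + ∑ i ∈ A', f i := fun f ↦ (Finset.add_sum_erase A f hi₁).symm
  let y : Fin m → galH1Torsion (W.baseChange K) ((2 ^ k : ℕ) : ℤ) := fun i ↦ if i ∈ A' then g i else 0
  have hy : ∀ i, y i ∈ S := fun i ↦ by
    by_cases hi : i ∈ A'
    · simp only [y, if_pos hi]; exact hgS i (hA'A hi)
    · simp only [y, if_neg hi]; exact S.zero_mem
  have hyτ : ∀ i, conjAct W τ ((2 ^ k : ℕ) : ℤ) (y i) = sg i • y i := fun i ↦ by
    by_cases hi : i ∈ A'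
    · simp only [y, if_pos hi]; exact hgτ i
    · simp only [y, if_neg hi]
      rw [zsmul_zero]; exact map_zero (conjAct W τ ((2 ^ k : ℕ) : ℤ))
  have hsumy : ∀ b : Fin m → ℤ, ∑ i, b i • y i = ∑ i ∈ A', b i • g i := fun b ↦ sum_smul_indicator g A' b
  haveI : Finite (↥(show AddSubgroup (galH1Torsion (W.baseChange K) ((2 ^ k : ℕ) : ℤ)) from S)) := ‹Finite S›
  obtain ⟨ℓ, hℓbnd, hKol, hidx, hreg, hloc⟩ :=
    RegularValueEngine.exists_regular_kolyvaginPrime_killing W hK hodd hH hk hρ2 hsurj hτ1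
      (show AddSubgroup (galH1Torsion (W.baseChange K) ((2 ^ k : ℕ) : ℤ)) from S) hSτ y hy sg hyτ
      (hgS i₁ hi₁) (hgS i₁ hi₁) hpτ hpτ (max bnd c)
  have hbnd : bnd < ℓ := lt_of_le_of_lt (le_max_left _ _) hℓbnd
  have hℓP : ℓ.Prime := hKol.1
  obtain ⟨hℓc, hcℓ, hℓmem, hboth⟩ := step_conductor hc hℓP (lt_of_le_of_lt (le_max_right _ _) hℓbnd)
    (P := fun ℓ' ↦ Zhang2014.IsKolyvaginPrime (W.conductorNorm ℤ) W K 2 ℓ' ∧ k + 1 ≤ Zhang2014.kolyvaginIndex W 2 ℓ')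
    (fun ℓ' h ↦ ⟨hkol ℓ' h, hkM ℓ' h⟩) ⟨hKol, hidx⟩
  have hkol' := fun ℓ' h ↦ (hboth ℓ' h).1
  have hkM' := fun ℓ' h ↦ (hboth ℓ' h).2
  obtain ⟨v, hv⟩ := exists_place_natCast_mem_of_kolyvaginPrime W hKol
  have hfix : τ • v = v := smul_place_eq_self_of_natCast_mem τ hℓP.ne_zero hKol.2.2.2.2.1 v hv
  have hvc : v ∈ placesDividing K (c * ℓ) := RegularRefill.mem_placesDividing_of_mem_primeFactors hcℓ hℓmem v hv
  obtain ⟨hkill, hcutp, -⟩ := hloc v hv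
  let loc : galH1Torsion (W.baseChange K) ((2 ^ k : ℕ) : ℤ) →+
      galoisCohomology (((W.baseChange K).torsionGaloisModule ((2 ^ k : ℕ) : ℤ)).toLocal (Sum.inr v : Place K)) 1 :=
    galoisCohomology.localization ((W.baseChange K).torsionGaloisModule ((2 ^ k : ℕ) : ℤ)) (Sum.inr v : Place K) 1
  have hkill' : ∀ i, loc (y i) = 0 := fun i ↦ hkill i
  have hcutp' : ∀ a : ℤ, a • loc (g i₁) = 0 → ∃ b : Fin m → ℤ,
      ∀ ρ ∈ torsionFixing (W.baseChange K) ((2 ^ (k + 1) : ℕ) : ℤ),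
        h1Eval (W.baseChange K) ((2 ^ k : ℕ) : ℤ) (a • g i₁ - ∑ i, b i • y i) ρ = 0 := fun a ha ↦ (hcutp a).mp ha
  have hτe' : ∀ S T, liftAutPlace τ hfix (e S T) =
      e ((isLiftOfAut_liftAutPlace τ hfix).torsionMap W ((2 ^ k : ℕ) : ℤ) S)
        ((isLiftOfAut_liftAutPlace τ hfix).torsionMap W ((2 ^ k : ℕ) : ℤ) T) :=
    weil_equivariant_of_isLiftOfAut W ((2 ^ k : ℕ) : ℤ) (isLiftOfAut_liftAutPlace τ hfix) (isLiftOfAut_liftAut τ)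
      e hgal hτe
  let 𝒯' : SelmerStructure ((W.baseChange K).torsionGaloisModule ((2 ^ k : ℕ) : ℤ)) := fun w ↦ match w with
    | Sum.inl _ => ⊤
    | Sum.inr w => ⨅ ℓ' ∈ (c * ℓ).primeFactors.filter (fun ℓ' : ℕ ↦ ((ℓ' : ℕ) : 𝓞 K) ∈ w.asIdeal),
        ⨅ (w' : HeightOneSpectrum (𝓞 (ringClassField K ι ℓ'))) (_ : w'.asIdeal.LiesOver w.asIdeal),
          letI := (adicCompletionOfLiesOver K (ringClassField K ι ℓ') w w').toAlgebra
          transverseSubgroup (GaloisRep.toLocal w ((W.baseChange K).torsionGaloisModule ((2 ^ k : ℕ) : ℤ)))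
            (w'.adicCompletion (ringClassField K ι ℓ'))
  have h𝒯' : ∀ w : HeightOneSpectrum (𝓞 K), 𝒯' (Sum.inr w) =
      ⨅ ℓ' ∈ (c * ℓ).primeFactors.filter (fun ℓ' : ℕ ↦ ((ℓ' : ℕ) : 𝓞 K) ∈ w.asIdeal),
        ⨅ (w' : HeightOneSpectrum (𝓞 (ringClassField K ι ℓ'))) (_ : w'.asIdeal.LiesOver w.asIdeal),
          letI := (adicCompletionOfLiesOver K (ringClassField K ι ℓ') w w').toAlgebra
          transverseSubgroup (GaloisRep.toLocal w ((W.baseChange K).torsionGaloisModule ((2 ^ k : ℕ) : ℤ)))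
            (w'.adicCompletion (ringClassField K ι ℓ')) := fun w ↦ rfl
  set 𝓛 := selmerF W ((2 ^ k : ℕ) : ℤ) 𝒯' (placesDividing K (c * ℓ)) with h𝓛def
  have hS'eq : 𝓛.selmerGroup = modifiedSelmerGroup W K ι ((2 ^ k : ℕ) : ℤ) (c * ℓ) :=
    selmerGroup_selmerF_eq_modifiedSelmerGroup_of_dvd W ι _ hcℓ dvd_rfl 𝒯' h𝒯'
  have hSeq : SelmerStructure.selmerGroup (Function.update 𝓛 (Sum.inr v : Place K)
        ((W.baseChange K).kummerSelmerStructure ((2 ^ k : ℕ) : ℤ) (Sum.inr v : Place K)) :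
        SelmerStructure ((W.baseChange K).torsionGaloisModule ((2 ^ k : ℕ) : ℤ))) = S :=
    selmerGroup_update_kummer_eq_modifiedSelmerGroup W ι _ hcℓ hℓP hKol.2.2.2.2.1 hv 𝒯' h𝒯'
  haveI : Finite (SelmerStructure.selmerGroup (Function.update 𝓛 (Sum.inr v : Place K)
        ((W.baseChange K).kummerSelmerStructure ((2 ^ k : ℕ) : ℤ) (Sum.inr v : Place K)) :
        SelmerStructure ((W.baseChange K).torsionGaloisModule ((2 ^ k : ℕ) : ℤ)))) := by
    rw [hSeq]; infer_instance
  have h𝓛v : 𝓛 (Sum.inr v) = 𝒯' (Sum.inr v) := by rw [h𝓛def, selmerF_inr, if_pos hvc]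
  have hmemS : ∀ {x : galH1Torsion (W.baseChange K) ((2 ^ k : ℕ) : ℤ)}, x ∈ S →
      x ∈ SelmerStructure.selmerGroup (Function.update 𝓛 (Sum.inr v : Place K)
      ((W.baseChange K).kummerSelmerStructure ((2 ^ k : ℕ) : ℤ) (Sum.inr v : Place K)) :
      SelmerStructure ((W.baseChange K).torsionGaloisModule ((2 ^ k : ℕ) : ℤ))) := fun hx ↦ by rwa [hSeq]
  have hlocKum : ∀ {x : galH1Torsion (W.baseChange K) ((2 ^ k : ℕ) : ℤ)}, x ∈ S →
      loc x ∈ (W.baseChange K).kummerSelmerStructure ((2 ^ k : ℕ) : ℤ) (Sum.inr v) := fun {x} hx ↦ by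
    have h := (SelmerStructure.mem_selmerGroup_iff _ _).mp (hmemS hx) (Sum.inr v)
    rwa [Function.update_self] at h
  have hlocT : ∀ {x : galH1Torsion (W.baseChange K) ((2 ^ k : ℕ) : ℤ)},
      x ∈ modifiedSelmerGroup W K ι ((2 ^ k : ℕ) : ℤ) (c * ℓ) → loc x ∈ 𝒯' (Sum.inr v) := fun {x} hx ↦ by
    rw [← hS'eq] at hx
    have h := (SelmerStructure.mem_selmerGroup_iff _ _).mp hx (Sum.inr v)
    rwa [h𝓛v] at h
  have hdisj : ((W.baseChange K).kummerSelmerStructure ((2 ^ k : ℕ) : ℤ) (Sum.inr v : Place K)) ⊓ 𝒯' (Sum.inr v) = ⊥ :=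
    RegularRefill.kummer_inf_transverse_eq_bot_two W k hK hD ι hk (c * ℓ) hcℓ hkol' hkM' 𝒯' h𝒯' v hvc
  have hsurvS : ∀ {x : galH1Torsion (W.baseChange K) ((2 ^ k : ℕ) : ℤ)},
      x ∈ modifiedSelmerGroup W K ι ((2 ^ k : ℕ) : ℤ) (c * ℓ) → loc x = 0 → x ∈ S := fun {x} hx h0 ↦ by
    rw [← hS'eq] at hx
    rw [← hSeq]
    exact RegularRefill.mem_update_kummer_of_localization_eq_zero (W := W) (k := k) (c := c * ℓ) (𝒯 := 𝒯') (v := v)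
      hvc hx h0
  have h2k' : ∀ x : galH1Torsion (W.baseChange K) ((2 ^ k : ℕ) : ℤ), (((2 ^ k : ℕ) : ℤ)) • x = 0 := fun x ↦
    zsmul_galH1Torsion_eq_zero (W.baseChange K) ((2 ^ k : ℕ) : ℤ) x
  have e2k : ((2 : ℤ) ^ k) = ((2 ^ k : ℕ) : ℤ) := by rw [Nat.cast_pow, Nat.cast_ofNat]
  have h2k : ∀ x : galH1Torsion (W.baseChange K) ((2 ^ k : ℕ) : ℤ), ((2 : ℤ) ^ k) • x = 0 := fun x ↦
    (congrArg (· • x) e2k).trans (h2k' x)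
  have h2kloc : ∀ x : galH1Torsion (W.baseChange K) ((2 ^ k : ℕ) : ℤ), (2 ^ k) • loc x = 0 := fun x ↦ by
    rw [← natCast_zsmul, ← map_zsmul, h2k', map_zero]
  have hcut : ∀ a : ℤ, a • loc (g i₁) = 0 → (2 : ℤ) ^ (k - d) ∣ a := by
    intro a ha
    obtain ⟨b, hb⟩ := hcutp' a ha
    let B : Fin m → ℤ := fun i ↦ (if i = i₁ then a else 0) + (if i ∈ A' then -b i else 0)
    have hB : ∑ i ∈ A, B i • g i = a • g i₁ - ∑ i, b i • y i := by
      rw [hsumy, sub_eq_add_neg, ← Finset.sum_neg_distrib,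
        Finset.sum_congr rfl (fun i _ ↦ (neg_zsmul (g i) (b i)).symm)]
      exact sum_single_add_indicator_smul g hA'A hi₁ a (fun i ↦ -b i)
    have hres : ∀ ρ ∈ torsionFixing (W.baseChange K) ((2 ^ (k + 1) : ℕ) : ℤ),
        h1Eval (W.baseChange K) ((2 ^ k : ℕ) : ℤ) (∑ i ∈ A, B i • g i) ρ = 0 := fun ρ hρ ↦ by
      rw [hB]; exact hb ρ hρ
    have h := hF4 B hres i₁ hi₁
    simpa [B, hi₁A'] using h
  obtain ⟨j₁, hj₁d, hj₁k, hpord⟩ := exists_addOrderOf_eq_two_pow (h2kloc (g i₁)) hcut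
  have e2j : ((2 ^ j₁ : ℕ) : ℤ) = (2 : ℤ) ^ j₁ := by rw [Nat.cast_pow, Nat.cast_ofNat]
  have hlocg : ∀ i ∈ A', loc (g i) = 0 := fun i hi ↦ by
    have h := hkill' i; simp only [y, if_pos hi] at h; exact h
  have hsurv : ∀ i ∈ A', g i ∈ modifiedSelmerGroup W K ι ((2 ^ k : ℕ) : ℤ) (c * ℓ) := by
    intro i hi
    rw [← hS'eq]
    exact RegularRefill.mem_selmerF_of_localization_eq_zero (W := W) (k := k) (c := c * ℓ) (𝒯 := 𝒯') (v := v) hvc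
      (hmemS (hgS i (hA'A hi))) (hlocg i hi)
  have hAp : ∀ u ∈ SelmerStructure.selmerGroup (Function.update 𝓛 (Sum.inr v : Place K)
      ((W.baseChange K).kummerSelmerStructure ((2 ^ k : ℕ) : ℤ) (Sum.inr v : Place K)) :
      SelmerStructure ((W.baseChange K).torsionGaloisModule ((2 ^ k : ℕ) : ℤ))),
      (2 ^ J) • galoisCohomology.localization ((W.baseChange K).torsionGaloisModule ((2 ^ k : ℕ) : ℤ))
        (Sum.inr v : Place K) 1 u ∈ AddSubgroup.zmultiples (galoisCohomology.localization
          ((W.baseChange K).torsionGaloisModule ((2 ^ k : ℕ) : ℤ)) (Sum.inr v : Place K) 1 (g i₁)) := by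
    intro u' hu'
    obtain ⟨u, rfl⟩ : ∃ u : galH1Torsion (W.baseChange K) ((2 ^ k : ℕ) : ℤ), u = u' := ⟨u', rfl⟩
    have huS : u ∈ S := by rw [← hSeq]; exact hu'
    obtain ⟨b, hb⟩ := hF3 u huS
    have h0 : loc (((2 : ℤ) ^ J) • u - ∑ i ∈ A, b i • g i) = 0 :=
      localization_eq_zero_of_res_eq_zero W hK hKol hidx v hv hb
    rw [map_sub, map_zsmul, hsplit, map_add, map_zsmul, map_sum,
      Finset.sum_eq_zero (fun i hi ↦ by rw [map_zsmul, hlocg i hi, smul_zero]), add_zero, sub_eq_zero] at h0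
    have e2J : ((2 ^ J : ℕ) : ℤ) = (2 : ℤ) ^ J := by rw [Nat.cast_pow, Nat.cast_ofNat]
    have h0' : (2 ^ J) • loc u = b i₁ • loc (g i₁) := by
      rw [← natCast_zsmul, e2J]; exact h0
    exact h0' ▸ AddSubgroup.zsmul_mem _ (AddSubgroup.mem_zmultiples _) _
  obtain ⟨r', hr'S', hr'gen, hr'ord⟩ := RegularRefill.exists_refill_class_of_pureCut (W := W) (k := k) (e := e) (hμ := hμ)
    (hadd₁ := hadd₁) (hadd₂ := hadd₂) (hgal := hgal) (halt := halt) (hnondeg := hnondeg) (inv := inv) (hK := hK)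
    (hD := hD) (ι := ι) (hk := hk) (c := c * ℓ) (hc := hcℓ) (hkol := hkol') (hkM := hkM') (𝒯 := 𝒯') (h𝒯 := h𝒯')
    (hperf := hperf) (hvan := hvan) (hcomp := hcomp) (hℓc := hℓmem) (hreg := hreg) (v := v) (hv := hv) (hτ1 := hτ1)
    (hfix := hfix) (hs := hs) (hjk := hj₁k) (hp := hmemS (hgS i₁ hi₁)) (hpτ := hpτ) (hpord := hpord) (hAp := hAp)
  obtain ⟨r, rfl⟩ : ∃ r : galH1Torsion (W.baseChange K) ((2 ^ k : ℕ) : ℤ), r = r' := ⟨r', rfl⟩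
  have hrS'mod : r ∈ modifiedSelmerGroup W K ι ((2 ^ k : ℕ) : ℤ) (c * ℓ) := by rw [← hS'eq]; exact hr'S'
  have hsign := RegularRefill.nsmul_conjActPlace_add_smul_localization_eq_zero (W := W) (k := k) (e := e) (hμ := hμ)
    (hadd₁ := hadd₁) (hadd₂ := hadd₂) (hgal := hgal) (halt := halt) (hnondeg := hnondeg) (inv := inv) (hK := hK)
    (hD := hD) (ι := ι) (hk := hk) (c := c * ℓ) (hc := hcℓ) (hkol := hkol') (hkM := hkM') (𝒯 := 𝒯') (h𝒯 := h𝒯')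
    (hperf := hperf) (hvan := hvan) (hℓc := hℓmem) (hreg := hreg) (v := v) (hv := hv) (hτ1 := hτ1) (hfix := hfix)
    (hs := hs) (hτe := hτe') (hinvc := hinvc) (hjk := hj₁k) (hz := hmemS (hgS i₁ hi₁)) (hzτ := hpτ) (hzord := hpord)
    (ht := hr'S')
  obtain ⟨hq'S', hq'τ, hq'ord⟩ := RegularRefill.oppositeSign_class (W := W) (k := k) (hK := hK) (ι := ι) (c := c * ℓ)
    (hc := hcℓ) (𝒯 := 𝒯') (h𝒯 := h𝒯') (v := v) (hfix := hfix) (hs := hs) (hr := hr'S') (hsign := hsign)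
  obtain ⟨q', hq'def⟩ : ∃ q' : galH1Torsion (W.baseChange K) ((2 ^ k : ℕ) : ℤ),
      conjAct W τ ((2 ^ k : ℕ) : ℤ) r - s • r = q' := ⟨_, rfl⟩
  rw [hq'def] at hq'S' hq'τ hq'ord
  have hq'mod : q' ∈ modifiedSelmerGroup W K ι ((2 ^ k : ℕ) : ℤ) (c * ℓ) := by rw [← hS'eq]; exact hq'S'
  have hordq : 2 ^ k ≤ 2 ^ (7 * d + 2 * J + 7) * addOrderOf (loc q') := by
    have h1 : 2 ^ k ≤ 2 ^ (6 * j₁ + 2 * J + 6) * (2 ^ (j₁ + 1) * addOrderOf (loc q')) :=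
      hr'ord.trans (Nat.mul_le_mul_left _ hq'ord)
    calc 2 ^ k ≤ 2 ^ (6 * j₁ + 2 * J + 6) * (2 ^ (j₁ + 1) * addOrderOf (loc q')) := h1
      _ = 2 ^ (7 * j₁ + 2 * J + 7) * addOrderOf (loc q') := by rw [← mul_assoc, ← pow_add]; congr 2; omega
      _ ≤ 2 ^ (7 * d + 2 * J + 7) * addOrderOf (loc q') :=
        Nat.mul_le_mul_right _ (Nat.pow_le_pow_right two_pos (by omega))
  have hconjr : loc (conjAct W τ ((2 ^ k : ℕ) : ℤ) r) = conjActPlace W τ ((2 ^ k : ℕ) : ℤ) hfix (loc r) :=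
    (conjActPlace_localization W τ ((2 ^ k : ℕ) : ℤ) hfix r).symm
  have hsign' : ((2 : ℤ) ^ j₁) • (conjActPlace W τ ((2 ^ k : ℕ) : ℤ) hfix (loc r) + s • loc r) = 0 := by
    have h := hsign
    rw [← natCast_zsmul, e2j] at h
    exact h
  have hρ₀loc : loc (((2 : ℤ) ^ j₁) • (r + s • conjAct W τ ((2 ^ k : ℕ) : ℤ) r)) = 0 := by
    rw [map_zsmul, map_add, map_zsmul, hconjr]
    have e1 : loc r + s • conjActPlace W τ ((2 ^ k : ℕ) : ℤ) hfix (loc r) =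
        s • (conjActPlace W τ ((2 ^ k : ℕ) : ℤ) hfix (loc r) + s • loc r) := by
      rw [smul_add, smul_smul, hs2, one_smul, add_comm]
    rw [e1, smul_comm, hsign', smul_zero]
  have hρ₀S : ((2 : ℤ) ^ j₁) • (r + s • conjAct W τ ((2 ^ k : ℕ) : ℤ) r) ∈ S :=
    hsurvS ((modifiedSelmerGroup W K ι _ (c * ℓ)).zsmul_mem
      (add_mem hrS'mod ((modifiedSelmerGroup W K ι _ (c * ℓ)).zsmul_mem
        (conjAct_mem_modifiedSelmerGroup W hK ι k hcℓ hrS'mod τ) _)) _) hρ₀loc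
  refine ⟨ℓ, hbnd, hℓc, hKol, hidx, hreg, q', hq'mod, hq'τ, hsurv, ?_, ?_⟩
  · -- (F3) at the new vertex, frame `g[i₁ ↦ q']`
    intro u hu
    have hu' : u ∈ 𝓛.selmerGroup := by rw [hS'eq]; exact hu
    obtain ⟨t, ht⟩ := hr'gen u hu'
    have ht' : ((2 : ℤ) ^ j₁) • loc u = t • (((2 : ℤ) ^ j₁) • loc r) := by
      have h := ht
      rw [← natCast_zsmul, ← natCast_zsmul, e2j] at h
      exact h
    have hσloc : loc (((2 : ℤ) ^ j₁) • (u - t • r)) = 0 := by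
      rw [map_zsmul, map_sub, map_zsmul, smul_sub, ht', smul_comm, sub_self]
    have hσS : ((2 : ℤ) ^ j₁) • (u - t • r) ∈ S :=
      hsurvS ((modifiedSelmerGroup W K ι _ (c * ℓ)).zsmul_mem
        (sub_mem hu ((modifiedSelmerGroup W K ι _ (c * ℓ)).zsmul_mem hrS'mod _)) _) hσloc
    have hYS : (2 : ℤ) • (((2 : ℤ) ^ j₁) • (u - t • r)) + t • (((2 : ℤ) ^ j₁) • (r + s • conjAct W τ ((2 ^ k : ℕ) : ℤ) r)) ∈ S :=
      add_mem (S.zsmul_mem hσS _) (S.zsmul_mem hρ₀S _)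
    obtain ⟨b, hb⟩ := hF3 _ hYS
    have hbp : b i₁ • loc (g i₁) = 0 := by
      have hw : loc (((2 : ℤ) ^ J) • ((2 : ℤ) • (((2 : ℤ) ^ j₁) • (u - t • r)) +
          t • (((2 : ℤ) ^ j₁) • (r + s • conjAct W τ ((2 ^ k : ℕ) : ℤ) r))) - ∑ i ∈ A, b i • g i) = 0 :=
        localization_eq_zero_of_res_eq_zero W hK hKol hidx v hv hb
      rw [map_sub, map_zsmul, map_add, map_zsmul, hσloc, map_zsmul, hρ₀loc, smul_zero, smul_zero, add_zero, smul_zero,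
        zero_sub, neg_eq_zero, hsplit, map_add, map_zsmul, map_sum,
        Finset.sum_eq_zero (fun i hi ↦ by rw [map_zsmul, hlocg i hi, smul_zero]), add_zero] at hw
      exact hw
    have hkillp : ((2 : ℤ) ^ j₁ * b i₁) • g i₁ = 0 :=
      RegularValueEngine.zsmul_eq_zero_of_dvd (h2k (g i₁)) (two_pow_dvd_mul_of_zsmul_eq_zero hj₁k hpord hbp)
    refine ⟨fun i ↦ (2 : ℤ) ^ (2 * (d - j₁)) * (if i = i₁ then -(t * s * 2 ^ (J + 2 * j₁)) else 2 ^ j₁ * b i),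
      fun ρ hρ ↦ ?_⟩
    have hsumupd : ∑ i ∈ A, ((2 : ℤ) ^ (2 * (d - j₁)) * (if i = i₁ then -(t * s * 2 ^ (J + 2 * j₁)) else 2 ^ j₁ * b i)) •
        Function.update g i₁ q' i =
        ((2 : ℤ) ^ (2 * (d - j₁))) • ((-(t * s * 2 ^ (J + 2 * j₁))) • q' + ((2 : ℤ) ^ j₁) • ∑ i ∈ A', b i • g i) := by
      rw [hsplit, Function.update_self, if_pos rfl, zsmul_add, zsmul_zsmul_eq_mul_zsmul, zsmul_finset_sum,
        zsmul_finset_sum]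
      congr 1
      refine Finset.sum_congr rfl fun i hi ↦ ?_
      have hne : i ≠ i₁ := Finset.ne_of_mem_erase hi
      rw [Function.update_of_ne hne, if_neg hne, zsmul_zsmul_eq_mul_zsmul, zsmul_zsmul_eq_mul_zsmul, mul_assoc]
    have hsumold : ∑ i ∈ A, b i • g i = b i₁ • g i₁ + ∑ i ∈ A', b i • g i := hsplit _
    have hid : ((2 : ℤ) ^ (J + 2 * j₁ + 1)) • u -
        ((-(t * s * 2 ^ (J + 2 * j₁))) • q' + ((2 : ℤ) ^ j₁) • ∑ i ∈ A', b i • g i) =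
        ((2 : ℤ) ^ j₁) • (((2 : ℤ) ^ J) • ((2 : ℤ) • (((2 : ℤ) ^ j₁) • (u - t • r)) +
          t • (((2 : ℤ) ^ j₁) • (r + s • conjAct W τ ((2 ^ k : ℕ) : ℤ) r))) - (b i₁ • g i₁ + ∑ i ∈ A', b i • g i)) +
          ((2 : ℤ) ^ j₁ * b i₁) • g i₁ := by
      rw [← hq'def]
      exact pure_step_identity W ((2 ^ k : ℕ) : ℤ) u r (conjAct W τ ((2 ^ k : ℕ) : ℤ) r) (g i₁) (∑ i ∈ A', b i • g i) t s
        (b i₁) hs J j₁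
    have hexp : ((2 : ℤ) ^ (J + 2 * d + 1)) • u -
        ∑ i ∈ A, ((2 : ℤ) ^ (2 * (d - j₁)) * (if i = i₁ then -(t * s * 2 ^ (J + 2 * j₁)) else 2 ^ j₁ * b i)) •
          Function.update g i₁ q' i =
        ((2 : ℤ) ^ (2 * (d - j₁))) • (((2 : ℤ) ^ j₁) • (((2 : ℤ) ^ J) • ((2 : ℤ) • (((2 : ℤ) ^ j₁) • (u - t • r)) +
          t • (((2 : ℤ) ^ j₁) • (r + s • conjAct W τ ((2 ^ k : ℕ) : ℤ) r))) - ∑ i ∈ A, b i • g i) +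
          ((2 : ℤ) ^ j₁ * b i₁) • g i₁) := by
      rw [hsumupd, hsumold, ← hid, zsmul_sub, zsmul_zsmul_eq_mul_zsmul, ← pow_add]
      congr 3
      omega
    rw [hexp, res_zsmul W k _ _ hρ, res_add W k _ _ hρ, res_zsmul W k _ _ hρ, hb ρ hρ, hkillp, smul_zero, zero_add,
      h1Eval_zero _ _ (torsionFixing_le_of_dvd (W.baseChange K) (by exact_mod_cast Nat.pow_dvd_pow 2 (Nat.le_succ k)) hρ),
      smul_zero]
  · -- (F4) at the new vertex, frame `g[i₁ ↦ q']`, exponent `8d + 2J + 7`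
    intro b hb i hi
    have hsumupd : ∑ i ∈ A, b i • Function.update g i₁ q' i = b i₁ • q' + ∑ i ∈ A', b i • g i := by
      rw [hsplit, Function.update_self]
      congr 1
      exact Finset.sum_congr rfl fun i hi ↦ by rw [Function.update_of_ne (Finset.ne_of_mem_erase hi)]
    have hbq : b i₁ • loc q' = 0 := by
      have hw : loc (∑ i ∈ A, b i • Function.update g i₁ q' i) = 0 :=
        localization_eq_zero_of_res_eq_zero W hK hKol hidx v hv hb
      rw [hsumupd, map_add, map_zsmul, map_sum, Finset.sum_eq_zero (fun i hi ↦ by rw [map_zsmul, hlocg i hi, smul_zero]),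
        add_zero] at hw
      exact hw
    have hdvdq : (2 : ℤ) ^ (k - (7 * d + 2 * J + 7)) ∣ b i₁ := by
      obtain ⟨N, hNk, hN⟩ := (Nat.dvd_prime_pow Nat.prime_two).mp (addOrderOf_dvd_of_nsmul_eq_zero (h2kloc q'))
      have h1 : ((2 ^ N : ℕ) : ℤ) ∣ b i₁ := by
        rw [← hN]; exact (addOrderOf_dvd_iff_zsmul_eq_zero).mpr hbq
      have h2 : k ≤ 7 * d + 2 * J + 7 + N := by
        have h3 : 2 ^ k ≤ 2 ^ (7 * d + 2 * J + 7 + N) := by rw [pow_add, ← hN]; exact hordq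
        exact (Nat.pow_le_pow_iff_right one_lt_two).mp h3
      have h4 : (2 : ℤ) ^ (k - (7 * d + 2 * J + 7)) ∣ ((2 ^ N : ℕ) : ℤ) := by
        rw [Nat.cast_pow, Nat.cast_ofNat]; exact pow_dvd_pow 2 (by omega)
      exact h4.trans h1
    have hkillq : ((2 : ℤ) ^ (7 * d + 2 * J + 7) * b i₁) • q' = 0 :=
      RegularValueEngine.zsmul_eq_zero_of_dvd (h2k q') (two_pow_dvd_mul_of_sub_dvd hdvdq)
    let B : Fin m → ℤ := fun i ↦ if i = i₁ then 0 else (2 : ℤ) ^ (7 * d + 2 * J + 7) * b i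
    have hB : ∑ i ∈ A, B i • g i = ((2 : ℤ) ^ (7 * d + 2 * J + 7)) • ∑ i ∈ A, b i • Function.update g i₁ q' i := by
      rw [hsumupd, zsmul_add, zsmul_zsmul_eq_mul_zsmul, hkillq, zero_add, zsmul_finset_sum, hsplit]
      simp only [B, if_pos rfl, zero_zsmul, zero_add]
      refine Finset.sum_congr rfl fun i hi ↦ ?_
      rw [if_neg (Finset.ne_of_mem_erase hi), zsmul_zsmul_eq_mul_zsmul]
    have hresB : ∀ ρ ∈ torsionFixing (W.baseChange K) ((2 ^ (k + 1) : ℕ) : ℤ),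
        h1Eval (W.baseChange K) ((2 ^ k : ℕ) : ℤ) (∑ i ∈ A, B i • g i) ρ = 0 := fun ρ hρ ↦ by
      rw [hB, res_zsmul W k _ _ hρ, hb ρ hρ, smul_zero]
    by_cases hii : i = i₁
    · subst hii
      exact (pow_dvd_pow 2 (by omega)).trans hdvdq
    · have h := hF4 B hresB i hi
      simp only [B, if_neg hii] at h
      have h' := two_pow_sub_dvd_of_dvd_mul h
      exact (pow_dvd_pow 2 (by omega)).trans h'

end Summit.BirchSwinnertonDyer.BirchSwinnertonDyer.Theorems.KolyvaginAtTwo.RegularWalk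

end
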